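import Literature.NumberTheory.Weil1964.ArchUnitaryBall
import HarnessLib

/-!
# The frame identity of `U(α, β)` on its bounded domain: `G · (1 Z; Zᴴ 1) = (1 Z′; Z′ᴴ 1) · diag(a + bZᴴ, cZ + d)`

Topic `NumberTheory/Weil1964`; namespace `Literature.NumberTheory.Weil1964.UnitaryBall`.  KERNEL throughout
(definitions with bodies and proved theorems only).  Sequel of `ArchUnitaryBall` (blocks `a b c d` of `G ∈ U(α,β)`, the
domain `ball α β = {Z : 1 − ZᴴZ ≻ 0}`, the Möbius map `moebius G Z = (aZ+b)(cZ+d)⁻¹`):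

* §3 the ISOTROPY IDENTITY `c + dZᴴ = (G·Z)ᴴ (a + bZᴴ)` (`G` maps the positive complement `V_Z⁺ = {(x, Zᴴx)}` of
  `V_Z⁻ = {(Zy, y)}` onto `V_{G·Z}⁺`), the FRAME IDENTITY `G · (1 Z; Zᴴ 1) = (1 Z′; Z′ᴴ 1) · diag(a + bZᴴ, cZ + d)`,
  `Z′ = G·Z` — in the frames `x ↦ (x, Zᴴx)`, `y ↦ (Zy, y)` the group acts by the CANONICAL AUTOMORPHY FACTORS
  `a + bZᴴ` and `cZ + d` — and its determinant `det G · det(1 − ZᴴZ) = det(1 − Z′ᴴZ′) · det(a + bZᴴ) · det(cZ + d)`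
  with `det(1 − ZᴴZ) > 0`; hence `a + bZᴴ` is invertible on the ball and
  `|det(a + bZᴴ)| |det(cZ + d)| = det(1 − ZᴴZ)/det(1 − Z′ᴴZ′)`;
* §4 the blocks of a product at the base point `0`: `(G·0)ᴴ = c a⁻¹`, `d(GG′) = (c·(G′·0) + d) d′`,
  `a(GG′) = (a + b (G′·0)ᴴ) a′`.

Consumers: `ArchUnitarySiegelEmbedding` (factorisation of Folland's automorphy factor `j(g, τ)` along the equivariant map
into the Siegel half-space) and `ArchMetaplecticUnitaryDetCharacter` (the genuine character `det^{1/2}` of the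
metaplectic two-fold cover over `U(α, β)`).  Sources: the canonical automorphy factors are the `G = U(α, β)` instance
of [Lee2004, §6.3 (6.27)–(6.30)] (originally [Satake1965]); the proofs are elementary block-matrix algebra.
-/

set_option autoImplicit false

noncomputable section

open Matrix Complex
open scoped ComplexOrder ComplexConjugate

namespace Literature.NumberTheory.Weil1964

open Literature.RepresentationTheory.KonnoKonno2007 Literature.RepresentationTheory.KonnoKonno2007.RealDualPair
open Literature.NumberTheory.Automorphic Literature.NumberTheory.Automorphic.UnitaryGroup

namespace UnitaryBall

variable {α β : Type*} [Fintype α] [DecidableEq α] [Fintype β] [DecidableEq β]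

/-! ## 3. The isotropy identity, the frame identity and its determinant -/

/-- **`(G·0)ᴴ = (b d⁻¹)ᴴ = c a⁻¹`** (from `bᴴa = dᴴc`). [cite: Lee2004, §6.3 (6.27)–(6.30)] -/
theorem conjTranspose_moebius_zero (G : UForm α β) : (moebius G 0)ᴴ = c G * (a G)⁻¹ := by
  have ha : IsUnit (a G).det := (Matrix.isUnit_iff_isUnit_det _).1 (isUnit_a G)
  have hd : IsUnit (d G)ᴴ.det := by
    rw [Matrix.det_conjTranspose, isUnit_iff_ne_zero, star_ne_zero]; exact det_d_ne_zero G
  rw [moebius_zero, Matrix.conjTranspose_mul, Matrix.conjTranspose_nonsing_inv]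
  have key : (d G)ᴴ * (c G * (a G)⁻¹) = (b G)ᴴ := by
    rw [← Matrix.mul_assoc, ← conjTranspose_b_mul_a, Matrix.mul_nonsing_inv_cancel_right _ _ ha]
  rw [← key, ← Matrix.mul_assoc, Matrix.nonsing_inv_mul _ hd, Matrix.one_mul]

omit [DecidableEq α] [DecidableEq β] in
/-- The polynomial identity behind the isotropy identity:
`(aZ+b)ᴴ(a + bZᴴ) − (cZ+d)ᴴ(c + dZᴴ) = Zᴴ(aᴴa − cᴴc) + Zᴴ(aᴴb − cᴴd)Zᴴ + (bᴴa − dᴴc) + (bᴴb − dᴴd)Zᴴ`. [folklore] -/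
private theorem isotropy_aux (a₀ : Matrix α α ℂ) (b₀ : Matrix α β ℂ) (c₀ : Matrix β α ℂ) (d₀ : Matrix β β ℂ)
    (Z : Matrix α β ℂ) :
    (a₀ * Z + b₀)ᴴ * (a₀ + b₀ * Zᴴ) - (c₀ * Z + d₀)ᴴ * (c₀ + d₀ * Zᴴ) =
      Zᴴ * (a₀ᴴ * a₀ - c₀ᴴ * c₀) + Zᴴ * (a₀ᴴ * b₀ - c₀ᴴ * d₀) * Zᴴ + (b₀ᴴ * a₀ - d₀ᴴ * c₀) +
        (b₀ᴴ * b₀ - d₀ᴴ * d₀) * Zᴴ := by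
  simp only [Matrix.conjTranspose_add, Matrix.conjTranspose_mul, Matrix.add_mul, Matrix.mul_add, Matrix.sub_mul,
    Matrix.mul_sub, Matrix.mul_assoc]
  abel

/-- **The isotropy identity** `c + dZᴴ = (G·Z)ᴴ(a + bZᴴ)`: `G` carries the positive complement
`V_Z⁺ = {(x, Zᴴx)} = (V_Z⁻)^⊥` of `V_Z⁻` onto `V_{G·Z}⁺` (orthogonality is preserved). [cite: Lee2004, §6.3 (6.27)–(6.30)] -/
theorem c_add_d_mul_conjTranspose (G : UForm α β) {Z : Matrix α β ℂ} (hZ : Z ∈ ball α β) :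
    c G + d G * Zᴴ = (moebius G Z)ᴴ * (a G + b G * Zᴴ) := by
  obtain ⟨h11, h12, h21, h22⟩ := block_relations G
  have hu : IsUnit (c G * Z + d G)ᴴ.det := by
    rw [Matrix.det_conjTranspose, isUnit_iff_ne_zero, star_ne_zero]; exact det_cd_ne_zero G hZ
  -- `(cZ+d)ᴴ (c + dZᴴ) = (aZ+b)ᴴ (a + bZᴴ)`
  have key : (c G * Z + d G)ᴴ * (c G + d G * Zᴴ) = (a G * Z + b G)ᴴ * (a G + b G * Zᴴ) := by
    rw [← sub_eq_zero, ← neg_sub, neg_eq_zero, isotropy_aux, h11, h12, h21, h22]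
    simp
  rw [moebius, Matrix.conjTranspose_mul, Matrix.conjTranspose_nonsing_inv, Matrix.mul_assoc, ← key,
    ← Matrix.mul_assoc, Matrix.nonsing_inv_mul _ hu, Matrix.one_mul]

/-- **The frame identity** `G · (1 Z; Zᴴ 1) = (1 Z′; Z′ᴴ 1) · diag(a + bZᴴ, cZ + d)`, `Z′ = G·Z`: in the frames
`x ↦ (x, Zᴴx)` of `V_Z⁺` and `y ↦ (Zy, y)` of `V_Z⁻`, `G` acts by `a + bZᴴ` and `cZ + d`. [cite: Lee2004, §6.3 (6.27)–(6.30)] -/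
theorem mat_mul_frame (G : UForm α β) {Z : Matrix α β ℂ} (hZ : Z ∈ ball α β) :
    mat G * Matrix.fromBlocks 1 Z Zᴴ 1 =
      Matrix.fromBlocks 1 (moebius G Z) (moebius G Z)ᴴ 1 * Matrix.fromBlocks (a G + b G * Zᴴ) 0 0 (c G * Z + d G) := by
  rw [mat_eq_fromBlocks, Matrix.fromBlocks_multiply, Matrix.fromBlocks_multiply]
  simp only [Matrix.mul_one, Matrix.one_mul, Matrix.mul_zero, add_zero, zero_add]
  rw [moebius_mul_cd G hZ, ← c_add_d_mul_conjTranspose G hZ]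

/-- **`k(Z) = det (1 Z; Zᴴ 1) = det(1 − ZᴴZ)`**. [cite: Lee2004, §6.3 (6.27)–(6.30)] -/
theorem det_frame (Z : Matrix α β ℂ) : (Matrix.fromBlocks 1 Z Zᴴ 1 : Matrix (α ⊕ β) (α ⊕ β) ℂ).det = (1 - Zᴴ * Z).det :=
  Matrix.det_fromBlocks_one₁₁ _ _ _

omit [DecidableEq α] in
/-- On the ball `det(1 − ZᴴZ)` is a positive real. [cite: Lee2004, §6.3 (6.27)–(6.30)] -/
theorem det_frame_pos {Z : Matrix α β ℂ} (hZ : Z ∈ ball α β) : 0 < (1 - Zᴴ * Z).det := hZ.det_pos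

omit [DecidableEq α] in
/-- On the ball `det(1 − ZᴴZ)` is real: it equals the cast of its real part. [cite: Lee2004, §6.3 (6.27)–(6.30)] -/
theorem det_frame_eq_re {Z : Matrix α β ℂ} (hZ : Z ∈ ball α β) :
    (1 - Zᴴ * Z).det = (((1 - Zᴴ * Z).det).re : ℂ) := by
  obtain ⟨_, him⟩ := Complex.lt_def.1 (det_frame_pos hZ)
  exact Complex.ext rfl (by simpa using him.symm)

omit [DecidableEq α] in
/-- On the ball `Re det(1 − ZᴴZ) > 0`. [cite: Lee2004, §6.3 (6.27)–(6.30)] -/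
theorem det_frame_re_pos {Z : Matrix α β ℂ} (hZ : Z ∈ ball α β) : 0 < ((1 - Zᴴ * Z).det).re :=
  (Complex.lt_def.1 (det_frame_pos hZ)).1

/-- **The determinant of the frame identity**:
`det G · det(1 − ZᴴZ) = det(1 − Z′ᴴZ′) · det(a + bZᴴ) · det(cZ + d)`, `Z′ = G·Z`. [cite: Lee2004, §6.3 (6.27)–(6.30)] -/
theorem det_mat_mul_det_frame (G : UForm α β) {Z : Matrix α β ℂ} (hZ : Z ∈ ball α β) :
    (mat G).det * (1 - Zᴴ * Z).det =
      (1 - (moebius G Z)ᴴ * moebius G Z).det * ((a G + b G * Zᴴ).det * (c G * Z + d G).det) := by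
  have h := congrArg Matrix.det (mat_mul_frame G hZ)
  rwa [Matrix.det_mul, Matrix.det_mul, det_frame, det_frame, Matrix.det_fromBlocks_zero₂₁] at h

/-- **`a + bZᴴ` is invertible on the ball.** [cite: Lee2004, §6.3 (6.27)–(6.30)] -/
theorem det_ab_ne_zero (G : UForm α β) {Z : Matrix α β ℂ} (hZ : Z ∈ ball α β) : (a G + b G * Zᴴ).det ≠ 0 := by
  intro h0
  have h := det_mat_mul_det_frame G hZ
  rw [h0, zero_mul, mul_zero] at h
  exact mul_ne_zero (det_mat_ne_zero G) (det_frame_pos hZ).ne' h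

/-- **`det G` is a positive multiple of `det(a + bZᴴ) det(cZ + d)`**: with the positive reals
`k = Re det(1 − ZᴴZ)`, `k′ = Re det(1 − Z′ᴴZ′)` one has `det G · k = k′ · det(a + bZᴴ) det(cZ + d)`. [cite: Lee2004, §6.3 (6.27)–(6.30)] -/
theorem det_mat_mul_re (G : UForm α β) {Z : Matrix α β ℂ} (hZ : Z ∈ ball α β) :
    (mat G).det * (((1 - Zᴴ * Z).det).re : ℂ) =
      (((1 - (moebius G Z)ᴴ * moebius G Z).det).re : ℂ) * ((a G + b G * Zᴴ).det * (c G * Z + d G).det) := by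
  rw [← det_frame_eq_re hZ, ← det_frame_eq_re (moebius_mem G hZ)]
  exact det_mat_mul_det_frame G hZ

/-- **`|det(a + bZᴴ)| · |det(cZ + d)| = k / k′`** — the modulus form of the determinant identity (`|det G| = 1`).
[cite: Lee2004, §6.3 (6.27)–(6.30)] -/
theorem norm_det_ab_mul_norm_det_cd (G : UForm α β) {Z : Matrix α β ℂ} (hZ : Z ∈ ball α β) :
    ‖(a G + b G * Zᴴ).det‖ * ‖(c G * Z + d G).det‖ * ((1 - (moebius G Z)ᴴ * moebius G Z).det).re =
      ((1 - Zᴴ * Z).det).re := by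
  have h := congrArg (fun z : ℂ => ‖z‖) (det_mat_mul_re G hZ)
  simp only [norm_mul, norm_det_mat, one_mul, Complex.norm_real, Real.norm_eq_abs,
    abs_of_pos (det_frame_re_pos hZ), abs_of_pos (det_frame_re_pos (moebius_mem G hZ))] at h
  linarith [h]

/-! ## 4. Blocks of a product at the base point -/

/-- **`d(GG′) = (c·(G′·0) + d) · d′`.** [cite: Lee2004, §6.3 (6.27)–(6.30)] -/
theorem d_mul (G G' : UForm α β) : d (G * G') = (c G * moebius G' 0 + d G) * d G' := by
  have hd : IsUnit (d G').det := (Matrix.isUnit_iff_isUnit_det _).1 (isUnit_d G')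
  have h : d (G * G') = c G * b G' + d G * d G' := by
    rw [d, mat_mul, mat_eq_fromBlocks G, mat_eq_fromBlocks G', Matrix.fromBlocks_multiply, Matrix.toBlocks_fromBlocks₂₂]
  rw [h, moebius_zero, Matrix.add_mul, Matrix.mul_assoc, Matrix.nonsing_inv_mul_cancel_right _ _ hd]

/-- **`a(GG′) = (a + b·(G′·0)ᴴ) · a′`.** [cite: Lee2004, §6.3 (6.27)–(6.30)] -/
theorem a_mul (G G' : UForm α β) : a (G * G') = (a G + b G * (moebius G' 0)ᴴ) * a G' := by
  have ha : IsUnit (a G').det := (Matrix.isUnit_iff_isUnit_det _).1 (isUnit_a G')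
  have h : a (G * G') = a G * a G' + b G * c G' := by
    rw [a, mat_mul, mat_eq_fromBlocks G, mat_eq_fromBlocks G', Matrix.fromBlocks_multiply, Matrix.toBlocks_fromBlocks₁₁]
  rw [h, conjTranspose_moebius_zero, Matrix.add_mul, Matrix.mul_assoc, Matrix.nonsing_inv_mul_cancel_right _ _ ha]

/-- **`|det d(GG′)| = |det(c·(G′·0) + d)| · |det d′|`.** [cite: Lee2004, §6.3 (6.27)–(6.30)] -/
theorem norm_det_d_mul (G G' : UForm α β) :
    ‖(d (G * G')).det‖ = ‖(c G * moebius G' 0 + d G).det‖ * ‖(d G').det‖ := by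
  rw [d_mul, Matrix.det_mul, norm_mul]

/-- **`|det a(GG′)| = |det(a + b (G′·0)ᴴ)| · |det a′|`.** [cite: Lee2004, §6.3 (6.27)–(6.30)] -/
theorem norm_det_a_mul (G G' : UForm α β) :
    ‖(a (G * G')).det‖ = ‖(a G + b G * (moebius G' 0)ᴴ).det‖ * ‖(a G').det‖ := by
  rw [a_mul, Matrix.det_mul, norm_mul]

end UnitaryBall

end Literature.NumberTheory.Weil1964
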